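import Literature.AnabelianGeometry.SemiGraphs.CoveringBranchFrames
import Literature.AnabelianGeometry.SemiGraphs.FiniteEtaleCoveringGlobalDef

/-!
# A point criterion for branch alignment, clause (i) ([SemiAnbd] §2 p. 23 / Rem. 2.4.2) — proof

Mochizuki, *Semi-graphs of anabelioids*, Publ. RIMS **42** (2006), §2 [cite: MochizukiSemiAnbd2006,
Rem. 2.4.2 p.26].  Clause (i) of `Hom.IsBranchAligned` (abc-iut-L4-t17, `ι⁻¹(Π_b^{al}) ≤ Π_{b′}`)
reduced to BASE POINTS: if `ι = π₁(φ_{v′})` is injective with image inside the stabiliser of a point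
`s₀ ∈ F(φ_{v′}^* X)`, the image of `π₁(φ_{e′})` contains the stabiliser of a point
`t₀ ∈ F_e(φ_{e′}^* Y)`, and a monomorphism `m : Y ↪ b^* X` carries `t₀` to `s₀` in the aligned frame
(POINT ALIGNMENT), then clause (i) holds at these basepoint data (`comap_alignedBranchSubgroup_le_of_point`).
For print's covering `𝒢_A → 𝒢` ([SemiAnbd] p. 23) the three hypotheses are: `Π_{v′} = Stab(s₀)`,
`Π_{e′} = Stab(t₀)` (abc-iut-L6-t17 `range_pi1Map_eq_stabilizer`) and the alignment of the
canonical sections through t5's `twoIso` (abc-iut-L6-d5 HANDOFF).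
-/

namespace Literature.AnabelianGeometry.SemiGraphs

open CategoryTheory CategoryTheory.Limits CategoryTheory.PreGaloisCategory
open Literature.AnabelianGeometry.Anabelioids

universe v₁ u₁ u

namespace SemiGraphOfAnabelioids

variable {𝒢' 𝒢 : SemiGraphOfAnabelioids.{v₁, u₁, u}}

/-- **Point criterion for clause (i) of branch alignment.** With `ι := π₁(φ_{v′})_{F′}` injective,
`ι(Π_{v′}) ⊆ Stab(s₀)`, `Stab(t₀) ⊆ Im π₁(φ_{e′})_{F_e′}`, a monomorphism `m : Y ↪ b^* X` and the point
alignment `alignIso_X(F_e′(φ_{e′}^* m)(t₀)) = s₀`: `ι⁻¹(Π_b^{al}) ≤ Π_{b′}`.  (If `ι(σ) = ` the aligned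
image of `π₁(b^*)(η)`, `η ∈ Π_e`, then `η` fixes `F_e(m)(t₀)`, hence `t₀` by naturality and
injectivity of `F_e(m)`, so `η ∈ Π_{e′}` and `σ ∈ Π_{b′}` by the 2-cell identity.)
[cite: MochizukiSemiAnbd2006, Rem. 2.4.2 p.26] -/
theorem comap_alignedBranchSubgroup_le_of_point (φ : Hom 𝒢' 𝒢) (b' : 𝒢'.graph.Branch)
    (v' : 𝒢'.graph.Vertex) (h' : 𝒢'.graph.abuts b' = some v') (b : 𝒢.graph.Branch)
    (p : φ.base.branchMap b' = b) (F' : 𝒢'.V v' ⥤ FintypeCat.{v₁}) [FiberFunctor F']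
    (Fe' : 𝒢'.E (𝒢'.graph.edgeOf b') ⥤ FintypeCat.{v₁}) [FiberFunctor Fe']
    (α' : (𝒢'.pull b' v' h').pullback ⋙ Fe' ≅ F')
    (hι : Function.Injective (pi1Map (φ.φV v').pullback F'))
    {X : 𝒢.V (φ.base.vertexMap v')} (s₀ : ((φ.φV v').pullback ⋙ F').obj X)
    (hs : (pi1Map (φ.φV v').pullback F').range ≤ MulAction.stabilizer _ s₀)
    {Y : 𝒢.E (𝒢.graph.edgeOf b)}
    (t₀ : ((φ.φE (𝒢'.graph.edgeOf b') (𝒢.graph.edgeOf b)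
      (p ▸ (φ.base.edgeOf_branchMap b').symm)).pullback ⋙ Fe').obj Y)
    (ht : MulAction.stabilizer _ t₀ ≤ (pi1Map (φ.φE (𝒢'.graph.edgeOf b') (𝒢.graph.edgeOf b)
      (p ▸ (φ.base.edgeOf_branchMap b').symm)).pullback Fe').range)
    (m : Y ⟶ (𝒢.pull b (φ.base.vertexMap v') (p ▸ φ.base.abuts_branchMap b' v' h')).pullback.obj X)
    [Mono m]
    (hpt : (φ.alignIso b' v' h' b p F' Fe' α').hom.app X
      (((φ.φE (𝒢'.graph.edgeOf b') (𝒢.graph.edgeOf b)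
        (p ▸ (φ.base.edgeOf_branchMap b').symm)).pullback ⋙ Fe').map m t₀) = s₀) :
    (φ.alignedBranchSubgroup b' v' h' b p F' Fe' α').comap (pi1Map (φ.φV v').pullback F') ≤
      𝒢'.branchSubgroup F' b' h' Fe' α' := by
  subst p
  -- the functors `R = φ_{e′}^*`, `Pb = b^*`, the basepoint `Ge = R ⋙ F_e′`, the frame `γ`
  let R := (φ.φE (𝒢'.graph.edgeOf b') (𝒢.graph.edgeOf (φ.base.branchMap b'))
    (φ.base.edgeOf_branchMap b').symm).pullback
  let Pb := (𝒢.pull (φ.base.branchMap b') (φ.base.vertexMap v')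
    (φ.base.abuts_branchMap b' v' h')).pullback
  let γ := φ.alignIso b' v' h' (φ.base.branchMap b') rfl F' Fe' α'
  haveI hR : PreservesFiniteLimits R := (φ.φE (𝒢'.graph.edgeOf b')
    (𝒢.graph.edgeOf (φ.base.branchMap b')) _).property.1
  haveI : R.PreservesMonomorphisms := preservesMonomorphisms_of_preservesLimitsOfShape R
  haveI : Fe'.PreservesMonomorphisms := preservesMonomorphisms_of_preservesLimitsOfShape Fe'
  haveI : Mono ((R ⋙ Fe').map m) := show Mono (Fe'.map (R.map m)) from inferInstance
  intro σ hσ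
  rw [Subgroup.mem_comap] at hσ
  obtain ⟨η, hx⟩ := hσ
  change Aut.autMulEquivOfIso γ (pi1Map Pb (R ⋙ Fe') η) = pi1Map (φ.φV v').pullback F' σ at hx
  -- `ι σ` fixes `s₀`, hence `π₁(b^*)(η)` fixes `γ⁻¹ s₀ = Ge(m)(t₀)`
  have hfix : (pi1Map (φ.φV v').pullback F' σ).hom.app X s₀ = s₀ := by
    have := hs ⟨σ, rfl⟩
    rwa [MulAction.mem_stabilizer_iff, mulAction_def] at this
  rw [← hx] at hfix
  change γ.hom.app X ((pi1Map Pb (R ⋙ Fe') η).hom.app X (γ.inv.app X s₀)) = s₀ at hfix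
  have hinv : γ.inv.app X s₀ = (R ⋙ Fe').map m t₀ := by
    rw [← hpt]
    exact FintypeCat.hom_inv_id_apply (γ.app X) _
  rw [hinv, pi1Map_hom_app] at hfix
  have hfix' : η.hom.app (Pb.obj X) ((R ⋙ Fe').map m t₀) = (R ⋙ Fe').map m t₀ := by
    apply (FintypeCat.equivEquivIso.symm (γ.app X)).injective
    exact hfix.trans hpt.symm
  -- naturality and injectivity of `Ge(m)`: `η` fixes `t₀`
  rw [FunctorToFintypeCat.naturality] at hfix'
  have ht₀ : η.hom.app Y t₀ = t₀ :=
    ConcreteCategory.injective_of_mono_of_preservesPullback ((R ⋙ Fe').map m) hfix'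
  -- so `η ∈ Π_{e′}`
  have hη : η ∈ (pi1Map R Fe').range := by
    apply ht
    rw [MulAction.mem_stabilizer_iff, mulAction_def]
    exact ht₀
  obtain ⟨τ, rfl⟩ := hη
  -- the 2-cell identity and injectivity of `ι`
  refine ⟨τ, hι ?_⟩
  change pi1Map (φ.φV v').pullback F'
      (Aut.autMulEquivOfIso α' (pi1Map (𝒢'.pull b' v' h').pullback Fe' τ)) = _
  rw [← hx]
  exact (autMulEquivOfIso_alignIso_pi1Map φ b' v' h' (φ.base.branchMap b') rfl F' Fe' α' τ).symm

end SemiGraphOfAnabelioids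

end Literature.AnabelianGeometry.SemiGraphs
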